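import Mathlib
import HarnessLib
import HarnessLib.Audit
import Summits.AtomisticToContinuum.Statement

/-!
Route: EmpiricalEnskogDuality

CLOSED (retired) 2026-08-15T13:42:05Z by operator:999:1257524 — reason: not-a-thesis: assembly does not conclude the sub-problem Statement — note: D-0027 §2.1 audit (human 2026-08-15: routes that do not decide the summit are removed): the assembly concludes `Literature.MathematicalPhysics.KineticTheory.HydrodynamicLimit`, not the sub-problem statement; a NEW conforming route may be opened from the same idea (generated `closes : … → _root_.Hydr. The file is kept as the record of this route; refuted decls are indexed as negative knowledge (`ledger negatives`).

# Route EmpiricalEnskogDuality — LLN-scale duality for the exact empirical Enskog identity —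
backward linearised-Enskog test functions leave one collision residual (Hoeffding remainder) as the
whole microscopic crux

It suffices to show X = CollisionResidualVanishes ∧ AdjointEnskogTestFamily (card
disjoint-regularity-empirical-enskog, its
constructive part (P3) "LLN-scale duality escape", with the bookkeeping corrected: the contact value
Y must sit inside the linearised
operator and the centring constant is the Hoeffding one). Never take a norm of μ^N_t − f_t (the
card's disjoint-regularity count (P1)
shows every Banach fixed point on the exact empirical Enskog equation is supercritical); instead
test the EXACT finite-N collision
identity of the empirical measure against an explicit family of backward test functions φ^N(s,x,v) =
α+β·v+γ|v|²/2 + κ/λ_N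
(hydrodynamic up to O(1/λ_N), λ_N = Nε_N² = σ²N^(1/3)) built on the Euler local Maxwellian f_s = ρ_s
M_(u_s,θ_s) and the test-side
linearised Enskog operator L^N_s (full pair increment, partner drawn from Y(σ³ρ_s)·f_s at distance
ε_N). The exact pathwise identity
⟨μ^N_t − f_t, φ_t⟩ = ⟨μ^N_0 − f_0, φ_0⟩ + ∫₀ᵗ⟨μ^N_s − f_s, (D+L^N_s)φ_s⟩ds + 𝓡_N[φ] − Res_N[φ]
leaves: CollisionResidualVanishes (K1) —
the collision residual 𝓡_N[φ] = (collision sum of φ-increments)/(N+1) − ∫⟨μ^N_s, L^N_sφ_s⟩ds +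
½∫⟨f_s, L^N_sφ_s⟩ds, i.e. the degenerate
(second-order Hoeffding) part of the collision U-statistic plus the conditional-mean chaos defect,
tends to 0 in mean square for every
admissible family; AdjointEnskogTestFamily (K2) — for smooth hydrodynamic terminal data there is an
admissible family with defect
|(D+L^N_s)φ^N| ≤ η_N(1+|v|²), convergent coefficients at s = 0 and Enskog defect Res_N[φ^N] of f → 0
(linear kinetic PDE). Then the four
terms are: t = 0 LLN (hypothesis), η_N × conserved energy, K1, K2 — giving the shared typed waypoint
L2HydroFields and the conjunct by Chebyshev.
Lean: `CollisionResidualVanishes ∧ AdjointEnskogTestFamily`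

## Assembly
Pure logic given the two support items: DualityReduction turns K1 and K2 into L2HydroFields, and
L2ToHydroLimit (= 0801, Chebyshev in
ℝ≥0∞) turns L2HydroFields into the conjunct; EquilibriumCollisionResidual is the special case of K1
at constant profiles (constants are
classical hs-Euler solutions for every T) and is not needed by the assembly — it is the stepping
stone / convention check; HsEosLowDensity
feeds K2 and K4. Checked sorry-free in Sketch.lean: `fun h1 h2 => L2ToHydroLimit (DualityReduction
h1 h2)`.

Rationale: WHY THIS LINE. Mechanism: linearised DUALITY for the exact empirical-measure Enskog identity
(Bogolyubov1975; PulvirentiSimonella2016, arXiv:1504.03215;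
PulvirentiSimonellaTrushechkin2018) around the strong Euler solution, in the spirit of the L²
test-function method of BGSR2017 (adjoint
linearised Boltzmann flow on test functions, Boltzmann–Grad, global equilibrium) transplanted to
FIXED reduced density (Enskog shifts ±ε_N and
contact value Y survive because λ_Nε_N = σ³) and to a NON-equilibrium local-Maxwellian background
(Hilbert expansion OF THE TEST FUNCTION:
adjoint linearised hs-Euler for (α,β,γ) plus a Chapman–Enskog-type corrector κ, Caflisch1980 /
GuoJangJiang2009 / Lachowicz1998 technology,
but linear). Imported from statistics: the Hoeffding/Hájek decomposition of the collision sum as a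
U-statistic over colliding pairs
(Hoeffding1963) — its first-order projection is EXACTLY ∫⟨μ^N_s, L^N_sφ_s⟩ds − ½∫⟨f_s,L^N_sφ_s⟩ds,
so K1 isolates the degenerate remainder +
the flux-weighted, time-averaged conditional-MEAN chaos defect: molecular chaos in the weakest form
the conjunct can live on (relative o(1)
accuracy of Enskog contact statistics in the mean, no law-level factorisation, no norm on μ^N − f).
What it does that the 40 open routes do
not: no relative entropy / Boltzmann hypothesis (RelEntropyErgodic, ChapmanEnskogCorrector,
KnudsenRate), no compactness / Young measures /
weak–strong uniqueness (CollisionMeasureChaos, DissipativeWeakStrong), no cumulant hierarchy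
(DenseKineticExpansion), no score calculus on
the data (OneParticleInfluence, AthermalWard): the PDE side is a LINEAR backward kinetic equation,
the microscopic side one mean-square
statement about an explicit trajectory functional. Negatives index empty at filing (2026-08-15).

RANKED CRUXES. #0 L2HydroFields (target) — the shared typed waypoint
(stmt-AtomisticToContinuum-0800): for all continuous profiles ∃σ₀ ∀σ<σ₀ ∀ classical hs-Euler
solutions on [0,T) ∀ flows, if the local Gibbs fields converge at t = 0 then for every t < T and
continuous χ the three empirical fields converge to (ρ, ρu, E)(t) in mean square (lintegral form).
This route enters it through DualityReduction. [deps: DualityReduction] [difficulty: open-problem]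
(why it might fail: in substance the open conjunct itself (L² ⇔ in probability here by energy
conservation); deterministic spheres at fixed σ may fail to keep local equilibrium on Euler times
(Spohn1991 I.3).) [Spohn1991, OllaVaradhanYau1993]
#2 CollisionResidualVanishes (crux) — COLLISION RESIDUAL → 0 IN MEAN SQUARE (card crux 1 + crux 3,
LLN scale, Y-corrected). For continuous profiles, σ < σ₀, every classical hs-Euler solution (ρ,u,θ)
on [0,T) matched to the data by the t = 0 LLN hypothesis, every family of flows, every t < T and
EVERY admissible test family φ^N(s,x,v) = α^N(s,x) + β^N(s,x)·v + γ^N(s,x)|v|²/2 + κ^N(s,x,v)/λ_N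
(typed with the coefficient triple c^N = (α^N,β^N,γ^N) : ℝ × ℝ³ × ℝ, jointly continuous, sup-bounded
and uniformly Lipschitz in x for the torus metric, and the kinetic corrector κ^N continuous with
|κ^N| ≤ C(1+|v|²) and |κ^N(s,x,v) − κ^N(s,x′,v′)| ≤ C(1+|v|²+|v′|²)(dist(x,x′)+|v−v′|), one C for
all N, s): ∫⁻ 𝓡_N[φ^N]² d(localGibbsLaw) → 0, where 𝓡_N[φ](z) = (N+1)⁻¹ Σ_{collision times s ∈
(0,t]} Σ_{ordered contact pairs (i,j)} [φ(s,x_i,v_i) − φ(s,x_i,v_i^pre)] − ∫₀ᵗ ⟨μ^N_s, L^N_s φ_s⟩ ds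
+ ½ ∫₀ᵗ∫∫ f_s L^N_sφ_s, with f_s = ρ_s·localMaxwellian 1 θ_s u_s, λ_N = N ε_N², Y(η) = (3/2π)
f_ex′(η), (L^N_sφ)(x,v) = λ_N ∫_{S²}∫ ((v−w)·ω)₊ Y(σ³ρ_s(x+εω/2)) f_s(x+εω,w)
[φ(x,v′)+φ(x+εω,w′)−φ(x,v)−φ(x+εω,w)] dw dσ(ω) with v′ = v − ((v−w)·ω)ω, w′ = w + ((v−w)·ω)ω
(sphereMeasure on S²; the kernel max((v−w)·ω,0) = hardSphereKernel spelled inline); pre-collisional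
velocities on the trajectory are reflectVel (in the separation direction) of the right-continuous
post-collisional ones. The subtracted terms are exactly the Hájek projection of the collision
U-statistic computed with the Enskog model, so 𝓡_N = degenerate remainder + conditional-mean chaos
defect. [deps: HsEosLowDensity] [difficulty: open-problem] (why it might fail: needs flux-weighted
contact pair correlations → Y·product with RELATIVE o(1) accuracy in time average along the true
flow, and F¹_N(s) → f_s; rings/caging give O(φ·Kn) dynamically (fine) but nothing rigorous controls
non-equilibrium contact statistics of deterministic spheres.) [PulvirentiSimonella2016,
Bogolyubov1975, Hoeffding1963, VanbeijerenErnst1973, Resibois1978, BGSSAnnals2023, Spohn1991]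
#3 AdjointEnskogTestFamily (crux) — BACKWARD LINEARISED-ENSKOG TEST FAMILY (card crux 2, typed as
approximate duality). ∃σ₀ ∀σ<σ₀, for every classical hs-Euler solution on [0,T), every t ∈ (0,T),
every smooth χ : 𝕋³ → ℝ (Torus.IsSmooth) and constants a, e ∈ ℝ, b ∈ ℝ³: there is an ADMISSIBLE
family (c^N, κ^N) (same class as in CollisionResidualVanishes) with (i) terminal data φ^N(t,x,v) =
χ(x)(a + b·v + e|v|²/2); (ii) C¹ along free-flight characteristics on [0,t]; (iii) defect |∂_r
φ^N(r, x+(r−s)v, v)|_{r=s} + L^N_sφ^N(s,x,v)| ≤ η_N(1+|v|²) on [0,t]×𝕋³×ℝ³ with η_N → 0; (iv) the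
hydrodynamic coefficient triple at s = 0 converges uniformly on 𝕋³ to a continuous limit c₀ =
(α₀,β₀,γ₀) (the adjoint linearised hs-Euler flow of the terminal data); (v) the Enskog defect of the
Euler local Maxwellian tested on the family, Res_N = ∫∫f_tφ^N_t − ∫∫f_0φ^N_0 − ∫₀ᵗ∫∫ f_s(Dφ^N_s +
½L^N_sφ^N_s), tends to 0 (hs-Euler with p = ρθZ(ρσ³) ⇔ the collisional transfer of λ_N Q^E_Y at
contact value Y = (Z−1)/((2π/3)η)). Construction foreseen: exact backward solution of ∂_sφ + v·∇_xφ
+ L^N_sφ = 0 (dissipative in reversed time) = Hilbert expansion of the TEST function, ψ + κ₁/λ +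
κ₂/λ² + remainder, with uniform polynomially weighted sup bounds. [deps: HsEosLowDensity]
[difficulty: L] (why it might fail: uniform-in-Kn weighted-L^∞ bounds for the stiff adjoint
linearised Enskog flow around an x-dependent local Maxwellian (variable θ, terminal layer of width
1/λ_N, quadratic velocity weight only) are not in print; needs the EOS smooth along the solution
(HsEosLowDensity).) [Caflisch1980, GuoJangJiang2009, Lachowicz1998, BGSR2017, Grad1963]
#4 EquilibriumCollisionResidual (crux) — GLOBAL-EQUILIBRIUM CASE OF THE COLLISION RESIDUAL (checks
every constant of the bookkeeping against statics). For constant profiles (activity a, velocity u,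
temperature θ; Euler solution ≡ (1, u, θ)), σ < σ₀, every family of flows, the equilibrium LLN at t
= 0 as hypothesis, every t ≥ 0 and every admissible test family: ∫⁻ 𝓡_N[φ^N]² d(Gibbs law) → 0. The
law is flow-invariant (Liouville on the hard-sphere domain × Maxwellians of the conserved energy and
momentum), so via the exact identity C_N[φ] = ⟨μ_t,φ_t⟩ − ⟨μ_0,φ_0⟩ − ∫⟨μ_s,Dφ_s⟩ (after mollifying
φ at a scale N^(−1/2) ≪ δ_N ≪ N^(−1/3)) everything reduces to STATIC statements about the canonical
hard-sphere gas on 𝕋³ at small packing: the one-body density is uniform, the contact value of the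
pair correlation tends to Y(σ³) = (Z(σ³)−1)/((2π/3)σ³) (virial theorem), and empirical averages have
O(1/N) variances (cluster expansion). [deps: CollisionResidualVanishes, HsEosLowDensity]
[difficulty: L] (why it might fail: a factor-2 / ordered-pair / λ_N = Nε² vs (N+1)ε² slip in 𝓡_N
shows up here as a nonzero deterministic limit ½∫fLφ·(error); also needs the canonical contact value
→ virial Y(σ³), i.e. differentiability of the limsup free energy (HsEosLowDensity, unproved in
tree).) [Ruelle1969, LebowitzPenrose1964, VanbeijerenErnst1973, Hoeffding1963]
#9 HsEosLowDensity (support) — shared support (stmt-AtomisticToContinuum-0768): the hard-sphere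
excess free energy is real-analytic on [0,η₀) with the canonical thermodynamic limit existing and
f_ex′(0) = 2π/3; makes Y and hsPressure smooth at small packing (used by K2's coefficients and K4's
contact value). [difficulty: L] [Ruelle1969, LebowitzPenrose1964]
#9 DualityReduction (support) — THE DUALITY GLUE (provable now, measure-theoretically heavy):
CollisionResidualVanishes → AdjointEnskogTestFamily → L2HydroFields. Proof: on the good set of the
flow (law ≪ Liouville) the orbit is a hard-sphere trajectory; piecewise FTC along free flights
(ContDiffOn along characteristics, derivWithin on [0,t]) plus the elastic jumps at the locally
finite collision times give the exact identity ⟨μ_t,φ_t⟩ − ⟨μ_0,φ_0⟩ = ∫⟨μ_s, g_s − L_sφ_s⟩ds +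
C_N[φ] with g the defect; combined with the definition of Res_N: ⟨ν_t, χ·e⟩ = ⟨ν_0, φ^N_0⟩ + ∫⟨ν_s,
g_s⟩ds + 𝓡_N − Res_N (ν = μ^N − f). Bound the four terms in L²: t = 0 hypothesis + uniform
convergence of (α^N,β^N,γ^N)(0) + |κ|/λ_N ≤ C(1+|v|²)/λ_N, using uniform integrability from the
Gaussian velocity marginal of the canonical law and conservation of kinetic energy along the flow;
η_N·t·(1 + 2K_N/(N+1)); K1; K2(v). Pass from smooth χ (trigonometric polynomials, dense in C(𝕋³)) to
continuous χ by the same moment bound; t = 0 is the hypothesis made L². [difficulty: provable-now]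
[PulvirentiSimonella2016, Hoeffding1963, Spohn1991]
#9 L2ToHydroLimit (support) — shared Chebyshev glue (stmt-AtomisticToContinuum-0801, proof attached
in its evidence): mean-square convergence of the fields implies convergence in probability, profile
by profile. [difficulty: provable-now] [OllaVaradhanYau1993, Spohn1991]

TWO-LAYER PLAN. Foreseen glued splits (none filed now): CollisionResidualVanishes ⇐ MeanChaosDefect
→ SelfAveraging → CollisionResidualVanishes, where
MeanChaosDefect = "if 𝓡_N[φ^N] concentrates around constants c_N then c_N → 0" (card crux 1: the
flux-weighted, time-averaged
conditional-MEAN chaos defect at contact relative to Y·f) and SelfAveraging = "∃ c_N with ∫⁻(𝓡_N −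
c_N)² → 0" (card crux 3: summable
decorrelation of pair residuals / macroscopic self-averaging of collision statistics).
AdjointEnskogTestFamily ⇐ AdjointHsEuler (smooth
backward solution of the adjoint linearised hs-Euler system with collisional-transfer terms,
terminal data χ·(a,b,c)) → KineticCorrector
(weighted-L^∞ inversion of the local test-side linearised operator on (1−P)-sources of cubic growth,
quadratic-growth output, Lipschitz in
(x,v)) → AdjointEnskogTestFamily (remainder/defect estimate for the stiff backward flow).
EquilibriumCollisionResidual ⇐ CanonicalContactValue
(static: canonical pair correlation at contact → Y(σ³), one-body density uniform, O(1/N) variances)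
→ EquilibriumIdentity (mollified exact
identity + invariance of the Gibbs law) → EquilibriumCollisionResidual.

KILL CRITERIA. ¬EquilibriumCollisionResidual with a NONZERO deterministic limit of 𝓡_N at
equilibrium refutes the bookkeeping (constants in L^N / the ½
centring): repairable once by `--restate` of K1/K4 with the corrected constant; a second failure
closes the route `refuted:CollisionResidualVanishes`.
¬CollisionResidualVanishes by an admissible family on which E𝓡_N has a nonzero limit at fixed σ
(e.g. an O(σ³) ring contribution to the
flux-weighted contact statistics that does not time-average away) closes the route outright
(`refuted:CollisionResidualVanishes`) and is a
typed negative for every Enskog-closure route (ChapmanEnskogCorrector C1, CollisionMeasureChaos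
CollisionRate, DenseKineticExpansion 0805).
¬AdjointEnskogTestFamily (no admissible family with quadratic velocity weight) forces a pivot:
weight (1+|v|²)^(3/2) in the defect plus a
cubic-moment crux (shared with ChapmanEnskogCorrector's CubicMomentsInMean / OneBodyEntropySqueeze's
CubicMomentUI). L2HydroFields proved by
any other route moots this one (close `superseded`).

NOT DECOMPOSED YET. The mean/variance split of K1 (layer 2 above); the three PDE lemmas inside K2
(adjoint hs-Euler existence, corrector inversion with
hard-sphere growth rates, stiff remainder estimate); the static cluster-expansion lemmas inside K4;
the uniform-integrability lemma for
local Gibbs velocity marginals and the trajectory identity inside DualityReduction (helper lemmas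
ride with `--supports DualityReduction`);
the card's DISJOINT-REGULARITY lemma (P1) and Boltzmann–Langevin reading (P2a) — negative knowledge
explaining why no norm is taken; they are
proposed for the barrier catalogue (see Definition requests), not filed as items; any CLT-scale
statement (the card's (P2b) says centring at
Enskog fails at the CLT scale at fixed φ — deliberately out of scope: this route is LLN-scale only).

CHEAPEST FALSIFIER. Paper-and-pencil at GLOBAL EQUILIBRIUM with the pure momentum test function φ =
β(x)·v (κ = 0): compute lim E𝓡_N from the canonical contact
value and check it is 0, i.e. that ½∫f L^Nφ equals the mean collision functional with λ_N = Nε²,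
ordered pairs and full increments as typed
(done here on paper: E C_N = ½E⟨μ,Lφ⟩ because each collision has two participants and conditioning
on one participant collects the FULL
increment — consistent; a refuter should redo it independently, it costs an hour). Numerically (kit,
not available in plancard mode):
event-driven MD of N = 10⁴–10⁵ spheres at packing 0.05 in a shear-wave initial state, measure
𝓡_N[β·v] directly; predicted |𝓡_N| ≲ N^(−1/3).

NUMBERS. λ_N = Nε_N² = σ²N^(1/3)·(N/(N+1))^(2/3) collisions per particle per unit time up to the
factor π⟨|v−w|⟩ρY; ε_Nλ_N = σ³N/(N+1) (collisional
transfer O(σ³), survives); Kn ≍ 1/λ_N; hydrodynamic increments Δψ = O(ε_N‖∇ψ‖) so C_N[ψ] = O(σ³)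
while C_N[κ]/λ_N = O(1); expected size of
the chaos defect in K1: relative O(φ_pack·Kn) (ring/shear correction to contact statistics, Lutsko
1996) → 0; card's count: incoherent part
sd ≍ N^(−1/3) on the hydrodynamic sector; Y(η) = 1 + (5π/12)η + O(η²), Z = 1 + (2π/3)ηY; freezing at
packing ≈ 0.494 bounds σ₀. Items at
open: 8 (3 cruxes, 1 target, 3 support, 1 assembly).

DEFINITION REQUESTS. None blocking (everything is inlined with `let`). Wanted for readability and
shared with CollisionMeasureChaos / DenseKineticExpansion 0805:
`enskogTestOperator` (the test-side linearised Enskog operator L^N above, topic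
Literature/Analysis/FluidPDE) and `empiricalCollisionSum`
(the finsum over collisionTimes ∩ (0,t] of ordered contact-pair increments of a HardSphereFlow
orbit) — to be filed by `ledger workitem add
--kind definition` once the route id exists. Barrier-catalogue proposal (operator/librarian):
DisjointRegularityEmpiricalEnskog — kernel (a)
tightness of √N(μ^N_0 − f_0) in Maxwellian-weighted H^(−s)(𝕋³×ℝ³) iff s > 3 (x-count: s > 3/2), (b)
the ω-averaged Enskog contact form is
bounded on H^σ_x × H^σ_x iff σ ≥ −1/2 (refuter-corrected), hence no translation-invariant Banach
scale makes the exact deviation equation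
(F) a locally Lipschitz ODE with O(1) data: Picard/Gronwall on the empirical Enskog equation is
supercritical at every λ_N ≥ c > 0.

Novelty: Searches (2026-08-15): `lit search --source crossref "Bodineau Gallagher Saint-Raymond hard sphere
dynamics Stokes Fourier L2"` (8: BGSR2017
doi:10.1007/s40818-016-0018-0, CRAS 2015 doi:10.1016/j.crma.2015.04.013, BGSS Annals 2023, BGSS CPAM
2023 doi:10.1002/cpa.22120, BGSR Invent.
2016); `lit search --source crossref "microscopic solutions Boltzmann-Enskog equation empirical
measure hard spheres Pulvirenti Simonella
Trushechkin"` (8: Bogolyubov1975, doi:10.3934/krm.2014.7.755, doi:10.3934/krm.2018036,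
PulvirentiSimonella2016 doi:10.1007/s00222-016-0682-4);
`lit search --source zbmath "Enskog equation hydrodynamic limit Euler"` (15: Lachowicz1988
doi:10.1007/bf00251460, Lachowicz1998
doi:10.2977/prims/1195144692, Golse–Saint-Raymond survey zbl:1109.35112); `lit search --source
zbmath "Enskog equation fluctuations central
limit theorem hard spheres"` (0); `lit search --source s2 "Enskog equation positive density hard
spheres rigorous derivation hydrodynamics
fluctuation fixed packing fraction" --year-from 2015` (1, irrelevant); `lit frontier
AtomisticToContinuum --since 2021` (30 rows: DHM
descendants arXiv:2602.04407, stochastic binary-collision fluctuations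
doi:10.1007/s10955-026-03570-w, nothing at fixed density by duality);
`lit galaxy search "linearized Enskog equation" --star all` (2 book hits on transport coefficients,
no mathematics); local `lit search
--hybrid` and OpenAlex/arXiv tiers unavailable this session (rc 75 / HTTP 429); grep of all 40 route
files of the sub-  [refs: 10.1007/s40818-016-0018-0, 10.1016/j.crma.2015.04.013, 10.1002/cpa.22120, 10.3934/krm.2014.7.755, 10.3934/krm.2018036, 10.1007/s00222-016-0682-4, 10.1007/bf00251460, 10.2977/prims/1195144692, 10.1007/s10955-026-03570-w, 2602.04407, 2004.00311, 1511.03057, doi:10.1007/s40818-016-0018-0, doi:10.1016/j.crma.2015.04.013, doi:10.1002/cpa.22120, doi:10.3934/krm.2014.7.755, doi:10.3934/krm.2018036, doi:1]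

Barriers (technique_class: duality, linearised-kinetic-adjoint, u-statistic): - technique_class: duality, linearised-kinetic-adjoint, u-statistic
- Literature.Barriers.AtomisticToContinuum.DiluteRegimeBarrier: evaded — no Boltzmann–Grad limit and
no Boltzmann equation for f^(1); (N+1)ε³ = σ³ is fixed, the Enskog shifts and Y(σ³ρ) sit inside L^N,
and the excess pressure ρθ(Z−1) is produced by the collisional transfer λ_Nε_N = σ³ (K2 (v)), so the
ideal-gas trap (kernel (a)) cannot occur; the Hilbert expansion here is of the TEST function against
the hs-EOS, outside the narrowed technique class (Boltzmann sub-family).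
- Literature.Barriers.AtomisticToContinuum.NoDensityExpansionBarrier: not met — nothing is expanded
in density and no transport coefficient appears (Euler scale, LLN); its ring physics is exactly "why
K1 might fail" and is bet to be relative O(φ·Kn) after flux weighting and time averaging, never
summed.
- Literature.Barriers.AtomisticToContinuum.BoltzmannHypothesisBarrier: outside its technique class —
no relative entropy, no classification of stationary states, no one-block replacement; local
equilibrium enters only through the explicit Euler local Maxwellian inside L^N and is TESTED (K1),
not assumed; on the barrier's kernels (ideal gas: L^N ≡ 0, 𝓡_N ≡ 0) K1 is vacuous and K2 (v) fails
exactly as Euler does — consistent.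
- Literature.Barriers.AtomisticToContinuum.HighMomentumCutoffBarrier: sidestepped — the only
velocity weight ever paired with μ^N_s is (1+|v|²), controlled by EXACT energy conservation; the
price is paid inside K2 (quadrat

History (route lifecycle, newest last):
- 2026-08-15T13:42:05Z · CLOSED retired — not-a-thesis: assembly does not conclude the sub-problem Statement (operator:999:1257524)

sub-problem: HydrodynamicLimit · status: closed(retired) · opened planner-plancard-AtomisticToContinuum-Hydrody-3dc92b24-0 2026-08-15T12:19:52Z · rev 0 · ledger route-AtomisticToContinuum-EmpiricalEnskogDuality
GENERATED by the gate from the ledger (D-0016/17). Provers cite these decls: `theorem foo : Summit.AtomisticToContinuum.HydrodynamicLimit.Theses.EmpiricalEnskogDuality.<Decl> := …` in Summits/AtomisticToContinuum/HydrodynamicLimit/Theorems/<Name>.lean.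
-/

namespace Summit.AtomisticToContinuum.HydrodynamicLimit.Theses.EmpiricalEnskogDuality

open scoped BigOperators Topology Manifold Classical MeasureTheory ProbabilityTheory Matrix InnerProductSpace ComplexConjugate ContinuousMap
open Filter Set Function TopologicalSpace MeasureTheory

attribute [summit_statement] _root_.HydrodynamicLimit

/-- item stmt-AtomisticToContinuum-0800 · target · rank 0 · closed · moot by None · by planner
why it might fail: in substance the open conjunct itself (L² ⇔ in probability here by energy conservation); deterministic spheres at fixed σ may fail to keep local equilibrium on Euler times (Spohn1991 I.3).
sources: Spohn1991, OllaVaradhanYau1993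
[target] Mean-square hydrodynamic limit (typed shadow of one- and two-point cumulant control): for
all continuous profiles ∃ σ₀ ∀ σ<σ₀ ∀ classical hs-Euler solutions on [0,T) ∀ flows, if the local
Gibbs fields converge at t = 0 then for every t < T and continuous χ the lower integrals ∫⁻ |density
field(Φ_t z; χ) − ∫χρ_t|², ∫⁻ ‖momentum field − ∫χρ_t u_t‖², ∫⁻ |energy field − ∫χE_t|² against
localGibbsLaw σ a₀ u₀ θ₀ N tend to 0 in ℝ≥0∞ (lintegral: no Bochner junk). Stronger than
TendstoHydroFieldsAt (adds uniform integrability); delivered by 1-marginal → local Maxwellian in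
(1+|v|²)-weighted L¹ and 2-marginal → product. -/
@[route_item "route-AtomisticToContinuum-EmpiricalEnskogDuality"]
def L2HydroFields : Prop :=
  ∀ (a₀ θ₀ : Literature.MathematicalPhysics.KineticTheory.T3 → ℝ) (u₀ : Literature.MathematicalPhysics.KineticTheory.T3 → Literature.MathematicalPhysics.KineticTheory.V3), Continuous a₀ → Continuous θ₀ → Continuous u₀ → (∀ x, 0 < a₀ x) → (∀ x, 0 < θ₀ x) → ∃ σ₀ : ℝ, 0 < σ₀ ∧ ∀ σ : ℝ, 0 < σ → σ < σ₀ → ∀ (T : ℝ) (ρ θ : ℝ → Literature.MathematicalPhysics.KineticTheory.T3 → ℝ) (u : ℝ → Literature.MathematicalPhysics.KineticTheory.T3 → Literature.MathematicalPhysics.KineticTheory.V3), Literature.MathematicalPhysics.KineticTheory.IsHardSphereEulerSolution σ T ρ u θ → ∀ Φ : (N : ℕ) → Literature.Analysis.FluidPDE.HardSphereFlow (Literature.Analysis.FluidPDE.Torus.geometry (Fin 3)) (Literature.MathematicalPhysics.KineticTheory.hsDiameter σ N) (N + 1), Literature.MathematicalPhysics.KineticTheory.TendstoHydroFieldsAt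 (fun N => Literature.MathematicalPhysics.KineticTheory.localGibbsLaw σ a₀ u₀ θ₀ N (Φ N)) Φ ρ u θ 0 → ∀ t ∈ Set.Ico 0 T, ∀ χ : Literature.MathematicalPhysics.KineticTheory.T3 → ℝ, Continuous χ → Filter.Tendsto (fun N : ℕ => ∫⁻ z, ENNReal.ofReal (|Literature.MathematicalPhysics.KineticTheory.empiricalDensityField ((Φ N).flow t z) χ - ∫ x, χ x * ρ t x| ^ 2) ∂(Literature.MathematicalPhysics.KineticTheory.localGibbsLaw σ a₀ u₀ θ₀ N (Φ N))) Filter.atTop (nhds 0) ∧ Filter.Tendsto (fun N : ℕ => ∫⁻ z, ENNReal.ofReal (‖Literature.MathematicalPhysics.KineticTheory.empiricalMomentumField ((Φ N).flow t z) χ - ∫ x, (χ x * ρ t x) • u t x‖ ^ 2) ∂(Literature.MathematicalPhysics.KineticTheory.localGibbsLaw σ a₀ u₀ θ₀ N (Φ N))) Filter.atTop (nhds 0) ∧ Filter.Tendsto (fun N : ℕ => ∫⁻ z, ENNReal.ofReal (|Literature.MathematicalPhysics.KineticTheory.empiricalEnergyField ((Φ N).flow t z) χ - ∫ x, χ x *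 Literature.MathematicalPhysics.KineticTheory.totalEnergyDensity (ρ t x) (u t x) (θ t x)| ^ 2) ∂(Literature.MathematicalPhysics.KineticTheory.localGibbsLaw σ a₀ u₀ θ₀ N (Φ N))) Filter.atTop (nhds 0)

/-- item stmt-AtomisticToContinuum-7916 · crux · rank 2 · closed · moot by None · by planner
why it might fail: needs flux-weighted contact pair correlations → Y·product with RELATIVE o(1) accuracy in time average along the true flow, and F¹_N(s) → f_s; rings/caging give O(φ·Kn) dynamically (fine) but nothing rigorous controls non-equilibrium contact statistics of deterministic spheres.
sources: PulvirentiSimonella2016, Bogolyubov1975, Hoeffding1963, VanbeijerenErnst1973, Resibois1978, BGSSAnnals2023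
[crux] COLLISION RESIDUAL → 0 IN MEAN SQUARE (card crux 1 + crux 3, LLN scale, Y-corrected). For
continuous profiles, σ < σ₀, every classical hs-Euler solution (ρ,u,θ) on [0,T) matched to the data
by the t = 0 LLN hypothesis, every family of flows, every t < T and EVERY admissible test family
φ^N(s,x,v) = α^N(s,x) + β^N(s,x)·v + γ^N(s,x)|v|²/2 + κ^N(s,x,v)/λ_N (typed with the coefficient
triple c^N = (α^N,β^N,γ^N) : ℝ × ℝ³ × ℝ, jointly continuous, sup-bounded and uniformly Lipschitz in
x for the torus metric, and the kinetic corrector κ^N continuous with |κ^N| ≤ C(1+|v|²) and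
|κ^N(s,x,v) − κ^N(s,x′,v′)| ≤ C(1+|v|²+|v′|²)(dist(x,x′)+|v−v′|), one C for all N, s): ∫⁻ 𝓡_N[φ^N]²
d(localGibbsLaw) → 0, where 𝓡_N[φ](z) = (N+1)⁻¹ Σ_{collision times s ∈ (0,t]} Σ_{ordered contact
pairs (i,j)} [φ(s,x_i,v_i) − φ(s,x_i,v_i^pre)] − ∫₀ᵗ ⟨μ^N_s, L^N_s φ_s⟩ ds + ½ ∫₀ᵗ∫∫ f_s L^N_sφ_s,
with f_s = ρ_s·localMaxwellian 1 θ_s u_s, λ_N = N ε_N², Y(η) = (3/2π) f_ex′(η), (L^N_sφ)(x,v) = λ_N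
∫_{S²}∫ ((v−w)·ω)₊ Y(σ³ρ_s(x+εω/2)) f_s(x+εω,w) [φ(x,v′)+φ(x+εω,w′)−φ(x,v)−φ(x+εω,w)] dw dσ(ω) with
v′ = v − ((v−w)·ω)ω, w′ = w + ((v−w)·ω)ω (sphereMeasure on S²; the kernel max((v−w)·ω,0) =
hardSphereKernel spelled inlin -/
@[route_item "route-AtomisticToContinuum-EmpiricalEnskogDuality"]
def CollisionResidualVanishes : Prop :=
  ∀ (a₀ θ₀ : UnitAddTorus (Fin 3) → ℝ) (u₀ : UnitAddTorus (Fin 3) → EuclideanSpace ℝ (Fin 3)), Continuous a₀ → Continuous θ₀ → Continuous u₀ → (∀ x, 0 < a₀ x) → (∀ x, 0 < θ₀ x) → ∃ σ₀ : ℝ, 0 < σ₀ ∧ ∀ σ : ℝ, 0 < σ → σ < σ₀ → ∀ (T : ℝ) (ρ θ : ℝ → UnitAddTorus (Fin 3) → ℝ) (u : ℝ → UnitAddTorus (Fin 3) → EuclideanSpace ℝ (Fin 3)), Literature.MathematicalPhysics.KineticTheory.IsHardSphereEulerSolution σ T ρ u θ → ∀ Φ : (N : ℕ) → Literature.Analysis.FluidPDE.HardSphereFlow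 (Literature.Analysis.FluidPDE.Torus.geometry (Fin 3)) (Literature.MathematicalPhysics.KineticTheory.hsDiameter σ N) (N + 1), Literature.MathematicalPhysics.KineticTheory.TendstoHydroFieldsAt (fun N => Literature.MathematicalPhysics.KineticTheory.localGibbsLaw σ a₀ u₀ θ₀ N (Φ N)) Φ ρ u θ 0 → ∀ t ∈ Set.Ico 0 T, ∀ (c : ℕ → ℝ → UnitAddTorus (Fin 3) → ℝ × EuclideanSpace ℝ (Fin 3) × ℝ) (κ : ℕ → ℝ → UnitAddTorus (Fin 3) → EuclideanSpace ℝ (Fin 3) → ℝ), (∀ N, Continuous (Function.uncurry (c N))) → (∀ N, Continuous (fun p : ℝ × UnitAddTorus (Fin 3) × EuclideanSpace ℝ (Fin 3) => κ N p.1 p.2.1 p.2.2)) → (∃ C : ℝ, ∀ N s x x' v v', ‖c N s x‖ ≤ C ∧ dist (c N s x) (c N s x') ≤ C * dist x x' ∧ |κ N s x v| ≤ C * (1 + ‖v‖ ^ 2) ∧ |κ N s x v - κ N s x' v'| ≤ C * (1 + ‖v‖ ^ 2 + ‖v'‖ ^ 2) * (dist x x' + ‖v - v'‖)) → let G := Literature.Analysis.FluidPDE.Torus.geometry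 (Fin 3); let ε := fun N : ℕ => Literature.MathematicalPhysics.KineticTheory.hsDiameter σ N; let lam := fun N : ℕ => (N : ℝ) * ε N ^ 2; let f := fun (s : ℝ) (x : UnitAddTorus (Fin 3)) (v : EuclideanSpace ℝ (Fin 3)) => ρ s x * Literature.Analysis.FluidPDE.localMaxwellian 1 (θ s x) (u s x) v; let Y := fun η : ℝ => 3 / (2 * Real.pi) * deriv Literature.MathematicalPhysics.KineticTheory.hsExcessFreeEnergy η; let φ := fun (N : ℕ) (s : ℝ) (x : UnitAddTorus (Fin 3)) (v : EuclideanSpace ℝ (Fin 3)) => (c N s x).1 + inner ℝ (c N s x).2.1 v + (c N s x).2.2 * ‖v‖ ^ 2 / 2 + (lam N)⁻¹ * κ N s x v; let L := fun (N : ℕ) (s : ℝ) (x : UnitAddTorus (Fin 3)) (v : EuclideanSpace ℝ (Fin 3)) => lam N * ∫ ω : Metric.sphere (0 : EuclideanSpace ℝ (Fin 3)) 1, (let y := G.translate x (ε N • (ω : EuclideanSpace ℝ (Fin 3))); ∫ w : EuclideanSpace ℝ (Fin 3), max (inner ℝ (v - w) ω) 0 * Y (σ ^ 3 * ρ s (G.translate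 x ((ε N / 2) • (ω : EuclideanSpace ℝ (Fin 3))))) * f s y w * (φ N s x (v - inner ℝ (v - w) ω • (ω : EuclideanSpace ℝ (Fin 3))) + φ N s y (w + inner ℝ (v - w) ω • (ω : EuclideanSpace ℝ (Fin 3))) - φ N s x v - φ N s y w)) ∂Literature.MathematicalPhysics.KineticTheory.sphereMeasure; let R := fun (N : ℕ) (z : Literature.Analysis.FluidPDE.Config (N + 1) (Fin 3) (UnitAddTorus (Fin 3))) => (let q := fun r : ℝ => (Φ N).flow r z; (N + 1 : ℝ)⁻¹ * (∑ᶠ (s : ℝ) (_ : s ∈ Literature.Analysis.FluidPDE.collisionTimes G (ε N) q ∩ Set.Ioc 0 t), ∑ i, ∑ j, (if i ≠ j ∧ ‖G.sepVec (q s i).1 (q s j).1‖ = ε N then φ N s (q s i).1 (q s i).2 - φ N s (q s i).1 (Literature.Analysis.FluidPDE.reflectVel (G.sepVec (q s i).1 (q s j).1) ((q s i).2, (q s j).2)).1 else 0)) - (∫ s in Set.Icc 0 t, ∫ y, L N s y.1 y.2 ∂(Literature.Analysis.FluidPDE.empiricalMeasure (q s))) + (1 / 2 : ℝ) * ∫ s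 in Set.Icc 0 t, ∫ x : UnitAddTorus (Fin 3), ∫ v : EuclideanSpace ℝ (Fin 3), f s x v * L N s x v); Filter.Tendsto (fun N : ℕ => ∫⁻ z, ENNReal.ofReal (R N z ^ 2) ∂(Literature.MathematicalPhysics.KineticTheory.localGibbsLaw σ a₀ u₀ θ₀ N (Φ N))) Filter.atTop (nhds 0)

/-- item stmt-AtomisticToContinuum-7917 · crux · rank 3 · closed · moot by None · by planner
why it might fail: uniform-in-Kn weighted-L^∞ bounds for the stiff adjoint linearised Enskog flow around an x-dependent local Maxwellian (variable θ, terminal layer of width 1/λ_N, quadratic velocity weight only) are not in print; needs the EOS smooth along the solution (HsEosLowDensity).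
sources: Caflisch1980, GuoJangJiang2009, Lachowicz1998, BGSR2017, Grad1963
[crux] BACKWARD LINEARISED-ENSKOG TEST FAMILY (card crux 2, typed as approximate duality). ∃σ₀
∀σ<σ₀, for every classical hs-Euler solution on [0,T), every t ∈ (0,T), every smooth χ : 𝕋³ → ℝ
(Torus.IsSmooth) and constants a, e ∈ ℝ, b ∈ ℝ³: there is an ADMISSIBLE family (c^N, κ^N) (same
class as in CollisionResidualVanishes) with (i) terminal data φ^N(t,x,v) = χ(x)(a + b·v + e|v|²/2);
(ii) C¹ along free-flight characteristics on [0,t]; (iii) defect |∂_r φ^N(r, x+(r−s)v, v)|_{r=s} +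
L^N_sφ^N(s,x,v)| ≤ η_N(1+|v|²) on [0,t]×𝕋³×ℝ³ with η_N → 0; (iv) the hydrodynamic coefficient triple
at s = 0 converges uniformly on 𝕋³ to a continuous limit c₀ = (α₀,β₀,γ₀) (the adjoint linearised
hs-Euler flow of the terminal data); (v) the Enskog defect of the Euler local Maxwellian tested on
the family, Res_N = ∫∫f_tφ^N_t − ∫∫f_0φ^N_0 − ∫₀ᵗ∫∫ f_s(Dφ^N_s + ½L^N_sφ^N_s), tends to 0 (hs-Euler
with p = ρθZ(ρσ³) ⇔ the collisional transfer of λ_N Q^E_Y at contact value Y = (Z−1)/((2π/3)η)).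
Construction foreseen: exact backward solution of ∂_sφ + v·∇_xφ + L^N_sφ = 0 (dissipative in
reversed time) = Hilbert expansion of the TEST function, ψ + κ₁/λ + κ₂/λ² + remainder, with uniform
polynomially weighted sup b -/
@[route_item "route-AtomisticToContinuum-EmpiricalEnskogDuality"]
def AdjointEnskogTestFamily : Prop :=
  ∃ σ₀ : ℝ, 0 < σ₀ ∧ ∀ σ : ℝ, 0 < σ → σ < σ₀ → ∀ (T : ℝ) (ρ θ : ℝ → UnitAddTorus (Fin 3) → ℝ) (u : ℝ → UnitAddTorus (Fin 3) → EuclideanSpace ℝ (Fin 3)), Literature.MathematicalPhysics.KineticTheory.IsHardSphereEulerSolution σ T ρ u θ → ∀ t ∈ Set.Ioo 0 T, ∀ χ : UnitAddTorus (Fin 3) → ℝ, Literature.Analysis.FunctionSpaces.Torus.IsSmooth χ → ∀ (a e : ℝ) (b : EuclideanSpace ℝ (Fin 3)), ∃ (c : ℕ → ℝ → UnitAddTorus (Fin 3) → ℝ × EuclideanSpace ℝ (Fin 3) × ℝ) (κ : ℕ → ℝ → UnitAddTorus (Fin 3) → EuclideanSpace ℝ (Fin 3) → ℝ), (∀ N,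 Continuous (Function.uncurry (c N))) ∧ (∀ N, Continuous (fun p : ℝ × UnitAddTorus (Fin 3) × EuclideanSpace ℝ (Fin 3) => κ N p.1 p.2.1 p.2.2)) ∧ (∃ C : ℝ, ∀ N s x x' v v', ‖c N s x‖ ≤ C ∧ dist (c N s x) (c N s x') ≤ C * dist x x' ∧ |κ N s x v| ≤ C * (1 + ‖v‖ ^ 2) ∧ |κ N s x v - κ N s x' v'| ≤ C * (1 + ‖v‖ ^ 2 + ‖v'‖ ^ 2) * (dist x x' + ‖v - v'‖)) ∧ (let G := Literature.Analysis.FluidPDE.Torus.geometry (Fin 3); let ε := fun N : ℕ => Literature.MathematicalPhysics.KineticTheory.hsDiameter σ N; let lam := fun N : ℕ => (N : ℝ) * ε N ^ 2; let f := fun (s : ℝ) (x : UnitAddTorus (Fin 3)) (v : EuclideanSpace ℝ (Fin 3)) => ρ s x * Literature.Analysis.FluidPDE.localMaxwellian 1 (θ s x) (u s x) v; let Y := fun η : ℝ => 3 / (2 * Real.pi) * deriv Literature.MathematicalPhysics.KineticTheory.hsExcessFreeEnergy η; let φ := fun (N : ℕ) (s : ℝ) (x : UnitAddTorus (Fin 3))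 (v : EuclideanSpace ℝ (Fin 3)) => (c N s x).1 + inner ℝ (c N s x).2.1 v + (c N s x).2.2 * ‖v‖ ^ 2 / 2 + (lam N)⁻¹ * κ N s x v; let L := fun (N : ℕ) (s : ℝ) (x : UnitAddTorus (Fin 3)) (v : EuclideanSpace ℝ (Fin 3)) => lam N * ∫ ω : Metric.sphere (0 : EuclideanSpace ℝ (Fin 3)) 1, (let y := G.translate x (ε N • (ω : EuclideanSpace ℝ (Fin 3))); ∫ w : EuclideanSpace ℝ (Fin 3), max (inner ℝ (v - w) ω) 0 * Y (σ ^ 3 * ρ s (G.translate x ((ε N / 2) • (ω : EuclideanSpace ℝ (Fin 3))))) * f s y w * (φ N s x (v - inner ℝ (v - w) ω • (ω : EuclideanSpace ℝ (Fin 3))) + φ N s y (w + inner ℝ (v - w) ω • (ω : EuclideanSpace ℝ (Fin 3))) - φ N s x v - φ N s y w)) ∂Literature.MathematicalPhysics.KineticTheory.sphereMeasure; (∀ N x v, φ N t x v = χ x * (a + inner ℝ b v + e * ‖v‖ ^ 2 / 2)) ∧ (∀ N x v, ContDiffOn ℝ 1 (fun r => φ N r (G.translate x (r • v)) v) (Set.Icc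 0 t)) ∧ (∃ η : ℕ → ℝ, Filter.Tendsto η Filter.atTop (nhds 0) ∧ ∀ N, ∀ s ∈ Set.Icc 0 t, ∀ x v, |derivWithin (fun r => φ N r (G.translate x ((r - s) • v)) v) (Set.Icc 0 t) s + L N s x v| ≤ η N * (1 + ‖v‖ ^ 2)) ∧ (∃ c₀ : UnitAddTorus (Fin 3) → ℝ × EuclideanSpace ℝ (Fin 3) × ℝ, Continuous c₀ ∧ ∀ δ : ℝ, 0 < δ → ∀ᶠ N in Filter.atTop, ∀ x, dist (c N 0 x) (c₀ x) ≤ δ) ∧ Filter.Tendsto (fun N : ℕ => (∫ x : UnitAddTorus (Fin 3), ∫ v : EuclideanSpace ℝ (Fin 3), f t x v * φ N t x v) - (∫ x : UnitAddTorus (Fin 3), ∫ v : EuclideanSpace ℝ (Fin 3), f 0 x v * φ N 0 x v) - ∫ s in Set.Icc 0 t, ∫ x : UnitAddTorus (Fin 3), ∫ v : EuclideanSpace ℝ (Fin 3), f s x v * (derivWithin (fun r => φ N r (G.translate x ((r - s) • v)) v) (Set.Icc 0 t) s + (1 / 2 : ℝ) * L N s x v)) Filter.atTop (nhds 0))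

/-- item stmt-AtomisticToContinuum-7918 · crux · rank 4 · closed · moot by None · by planner
why it might fail: a factor-2 / ordered-pair / λ_N = Nε² vs (N+1)ε² slip in 𝓡_N shows up here as a nonzero deterministic limit ½∫fLφ·(error); also needs the canonical contact value → virial Y(σ³), i.e. differentiability of the limsup free energy (HsEosLowDensity, unproved in tree).
sources: Ruelle1969, LebowitzPenrose1964, VanbeijerenErnst1973, Hoeffding1963
[crux] GLOBAL-EQUILIBRIUM CASE OF THE COLLISION RESIDUAL (checks every constant of the bookkeeping
against statics). For constant profiles (activity a, velocity u, temperature θ; Euler solution ≡ (1,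
u, θ)), σ < σ₀, every family of flows, the equilibrium LLN at t = 0 as hypothesis, every t ≥ 0 and
every admissible test family: ∫⁻ 𝓡_N[φ^N]² d(Gibbs law) → 0. The law is flow-invariant (Liouville on
the hard-sphere domain × Maxwellians of the conserved energy and momentum), so via the exact
identity C_N[φ] = ⟨μ_t,φ_t⟩ − ⟨μ_0,φ_0⟩ − ∫⟨μ_s,Dφ_s⟩ (after mollifying φ at a scale N^(−1/2) ≪ δ_N
≪ N^(−1/3)) everything reduces to STATIC statements about the canonical hard-sphere gas on 𝕋³ at
small packing: the one-body density is uniform, the contact value of the pair correlation tends to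
Y(σ³) = (Z(σ³)−1)/((2π/3)σ³) (virial theorem), and empirical averages have O(1/N) variances (cluster
expansion). [deps: CollisionResidualVanishes, HsEosLowDensity] [difficulty: L] -/
@[route_item "route-AtomisticToContinuum-EmpiricalEnskogDuality"]
def EquilibriumCollisionResidual : Prop :=
  ∀ (a th : ℝ) (uu : EuclideanSpace ℝ (Fin 3)), 0 < a → 0 < th → ∃ σ₀ : ℝ, 0 < σ₀ ∧ ∀ σ : ℝ, 0 < σ → σ < σ₀ → ∀ Φ : (N : ℕ) → Literature.Analysis.FluidPDE.HardSphereFlow (Literature.Analysis.FluidPDE.Torus.geometry (Fin 3)) (Literature.MathematicalPhysics.KineticTheory.hsDiameter σ N) (N + 1), Literature.MathematicalPhysics.KineticTheory.TendstoHydroFieldsAt (fun N => Literature.MathematicalPhysics.KineticTheory.localGibbsLaw σ (fun _ => a) (fun _ => uu) (fun _ => th) N (Φ N)) Φ (fun _ _ => 1) (fun _ _ => uu) (fun _ _ => th) 0 → ∀ t : ℝ, 0 ≤ t → ∀ (c : ℕ → ℝ → UnitAddTorus (Fin 3) → ℝ × EuclideanSpace ℝ (Fin 3) × ℝ) (κ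 : ℕ → ℝ → UnitAddTorus (Fin 3) → EuclideanSpace ℝ (Fin 3) → ℝ), (∀ N, Continuous (Function.uncurry (c N))) → (∀ N, Continuous (fun p : ℝ × UnitAddTorus (Fin 3) × EuclideanSpace ℝ (Fin 3) => κ N p.1 p.2.1 p.2.2)) → (∃ C : ℝ, ∀ N s x x' v v', ‖c N s x‖ ≤ C ∧ dist (c N s x) (c N s x') ≤ C * dist x x' ∧ |κ N s x v| ≤ C * (1 + ‖v‖ ^ 2) ∧ |κ N s x v - κ N s x' v'| ≤ C * (1 + ‖v‖ ^ 2 + ‖v'‖ ^ 2) * (dist x x' + ‖v - v'‖)) → let ρ := fun (_ : ℝ) (_ : UnitAddTorus (Fin 3)) => (1 : ℝ); let u := fun (_ : ℝ) (_ : UnitAddTorus (Fin 3)) => uu; let θ := fun (_ : ℝ) (_ : UnitAddTorus (Fin 3)) => th; let G := Literature.Analysis.FluidPDE.Torus.geometry (Fin 3); let ε := fun N : ℕ => Literature.MathematicalPhysics.KineticTheory.hsDiameter σ N; let lam := fun N : ℕ => (N : ℝ) * ε N ^ 2; let f := fun (s : ℝ) (x : UnitAddTorus (Fin 3)) (v :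 EuclideanSpace ℝ (Fin 3)) => ρ s x * Literature.Analysis.FluidPDE.localMaxwellian 1 (θ s x) (u s x) v; let Y := fun η : ℝ => 3 / (2 * Real.pi) * deriv Literature.MathematicalPhysics.KineticTheory.hsExcessFreeEnergy η; let φ := fun (N : ℕ) (s : ℝ) (x : UnitAddTorus (Fin 3)) (v : EuclideanSpace ℝ (Fin 3)) => (c N s x).1 + inner ℝ (c N s x).2.1 v + (c N s x).2.2 * ‖v‖ ^ 2 / 2 + (lam N)⁻¹ * κ N s x v; let L := fun (N : ℕ) (s : ℝ) (x : UnitAddTorus (Fin 3)) (v : EuclideanSpace ℝ (Fin 3)) => lam N * ∫ ω : Metric.sphere (0 : EuclideanSpace ℝ (Fin 3)) 1, (let y := G.translate x (ε N • (ω : EuclideanSpace ℝ (Fin 3))); ∫ w : EuclideanSpace ℝ (Fin 3), max (inner ℝ (v - w) ω) 0 * Y (σ ^ 3 * ρ s (G.translate x ((ε N / 2) • (ω : EuclideanSpace ℝ (Fin 3))))) * f s y w * (φ N s x (v - inner ℝ (v - w) ω • (ω : EuclideanSpace ℝ (Fin 3))) + φ N s y (w + inner ℝ (v - w) ω • (ω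 : EuclideanSpace ℝ (Fin 3))) - φ N s x v - φ N s y w)) ∂Literature.MathematicalPhysics.KineticTheory.sphereMeasure; let R := fun (N : ℕ) (z : Literature.Analysis.FluidPDE.Config (N + 1) (Fin 3) (UnitAddTorus (Fin 3))) => (let q := fun r : ℝ => (Φ N).flow r z; (N + 1 : ℝ)⁻¹ * (∑ᶠ (s : ℝ) (_ : s ∈ Literature.Analysis.FluidPDE.collisionTimes G (ε N) q ∩ Set.Ioc 0 t), ∑ i, ∑ j, (if i ≠ j ∧ ‖G.sepVec (q s i).1 (q s j).1‖ = ε N then φ N s (q s i).1 (q s i).2 - φ N s (q s i).1 (Literature.Analysis.FluidPDE.reflectVel (G.sepVec (q s i).1 (q s j).1) ((q s i).2, (q s j).2)).1 else 0)) - (∫ s in Set.Icc 0 t, ∫ y, L N s y.1 y.2 ∂(Literature.Analysis.FluidPDE.empiricalMeasure (q s))) + (1 / 2 : ℝ) * ∫ s in Set.Icc 0 t, ∫ x : UnitAddTorus (Fin 3), ∫ v : EuclideanSpace ℝ (Fin 3), f s x v * L N s x v); Filter.Tendsto (fun N : ℕ => ∫⁻ z, ENNReal.ofReal (R N z ^ 2)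 ∂(Literature.MathematicalPhysics.KineticTheory.localGibbsLaw σ (fun _ => a) (fun _ => uu) (fun _ => th) N (Φ N))) Filter.atTop (nhds 0)

/-- item stmt-AtomisticToContinuum-0768 · support · rank 9 · open · by planner
sources: Ruelle1969, LebowitzPenrose1964
[support] Hard-sphere equation of state at low density: ∃ η₀ > 0 and F real-analytic on (−η₀, η₀)
with hsExcessFreeEnergy = F on [0, η₀), F(0) = 0, F'(0) = 2π/3 (second virial coefficient of
unit-diameter spheres), and the canonical thermodynamic limit −N⁻¹ log hsFreeVolume η N → F(η)
exists (not just limsup) for η ∈ [0, η₀). Ruelle1969 §3.4 (existence), LebowitzPenrose1964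
(convergence of the virial expansion ⇒ analyticity). Makes hsCompressibility/hsPressure smooth and
Z(η) = 1 + (2π/3)η + O(η²); needed by every route (hyperbolicity of the Euler system, virial
theorem). -/
@[route_item "route-AtomisticToContinuum-EmpiricalEnskogDuality"]
def HsEosLowDensity : Prop :=
  ∃ η₀ : ℝ, 0 < η₀ ∧ ∃ F : ℝ → ℝ, AnalyticOnNhd ℝ F (Set.Ioo (-η₀) η₀) ∧ Set.EqOn Literature.MathematicalPhysics.KineticTheory.hsExcessFreeEnergy F (Set.Ico 0 η₀) ∧ F 0 = 0 ∧ deriv F 0 = 2 * Real.pi / 3 ∧ ∀ η ∈ Set.Ico 0 η₀, Filter.Tendsto (fun N : ℕ => -(N : ℝ)⁻¹ * Real.log (Literature.MathematicalPhysics.KineticTheory.hsFreeVolume η N)) Filter.atTop (nhds (F η))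

/-- item stmt-AtomisticToContinuum-0801 · support · rank 9 · closed · moot by None · by planner
sources: OllaVaradhanYau1993, Spohn1991
[assembly] L2HydroFields → HydrodynamicLimit: Markov/Chebyshev in ℝ≥0∞
(MeasureTheory.meas_ge_le_lintegral_div or mul_meas_ge_le_lintegral): P{δ < |F|} ≤ δ⁻² ∫⁻ ofReal
|F|², measurability of z ↦ field((Φ N).flow t z) from measurable_flow and continuity of χ (or use
the outer-measure form), then squeeze. -/
@[route_item "route-AtomisticToContinuum-EmpiricalEnskogDuality"]
def L2ToHydroLimit : Prop :=
  L2HydroFields → Literature.MathematicalPhysics.KineticTheory.HydrodynamicLimit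

/-- item stmt-AtomisticToContinuum-7919 · support · rank 9 · closed · moot by None · by planner
sources: PulvirentiSimonella2016, Hoeffding1963, Spohn1991
[support] THE DUALITY GLUE (provable now, measure-theoretically heavy): CollisionResidualVanishes →
AdjointEnskogTestFamily → L2HydroFields. Proof: on the good set of the flow (law ≪ Liouville) the
orbit is a hard-sphere trajectory; piecewise FTC along free flights (ContDiffOn along
characteristics, derivWithin on [0,t]) plus the elastic jumps at the locally finite collision times
give the exact identity ⟨μ_t,φ_t⟩ − ⟨μ_0,φ_0⟩ = ∫⟨μ_s, g_s − L_sφ_s⟩ds + C_N[φ] with g the defect;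
combined with the definition of Res_N: ⟨ν_t, χ·e⟩ = ⟨ν_0, φ^N_0⟩ + ∫⟨ν_s, g_s⟩ds + 𝓡_N − Res_N (ν =
μ^N − f). Bound the four terms in L²: t = 0 hypothesis + uniform convergence of (α^N,β^N,γ^N)(0) +
|κ|/λ_N ≤ C(1+|v|²)/λ_N, using uniform integrability from the Gaussian velocity marginal of the
canonical law and conservation of kinetic energy along the flow; η_N·t·(1 + 2K_N/(N+1)); K1; K2(v).
Pass from smooth χ (trigonometric polynomials, dense in C(𝕋³)) to continuous χ by the same moment
bound; t = 0 is the hypothesis made L². [difficulty: provable-now] -/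
@[route_item "route-AtomisticToContinuum-EmpiricalEnskogDuality"]
def DualityReduction : Prop :=
  CollisionResidualVanishes → AdjointEnskogTestFamily → L2HydroFields

/-- item stmt-AtomisticToContinuum-7920 · assembly · rank 1 · closed · moot by None · by planner
sources: Spohn1991, OllaVaradhanYau1993, BGSR2017
[assembly] CollisionResidualVanishes → AdjointEnskogTestFamily → HydrodynamicLimit (via
DualityReduction and L2ToHydroLimit). -/
@[route_item "route-AtomisticToContinuum-EmpiricalEnskogDuality"]
def Assembly : Prop :=
  CollisionResidualVanishes → AdjointEnskogTestFamily → Literature.MathematicalPhysics.KineticTheory.HydrodynamicLimit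

end Summit.AtomisticToContinuum.HydrodynamicLimit.Theses.EmpiricalEnskogDuality
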